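import Mathlib
import Summits.KontsevichZagierPeriods.Zeta5Search.Families.DualSpanProdCoeff
import Summits.KontsevichZagierPeriods.Zeta5Search.Families.CellularBrownZudilinGrowth
import Summits.KontsevichZagierPeriods.Zeta5Search.SymRayWedgeDictionary
import Summits.KontsevichZagierPeriods.Zeta5Search.SymmetricFamilyRecursion
import HarnessLib

/-!
# ζ(5) search — Families: the dual constant term in closed form, kernel instances of CONJECTURE D-exact,
# and what D-exact implies for the growth of the leading coefficients

HONEST FRAMING: systematic search; no irrationality claim unless certified.  Cell `pub-zeta5`, certifier 2
(cert-2 g7, 2026-08-21).  Identities / inequalities between integers and values of a polynomial with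
non-negative coefficients; nothing about the arithmetic of `ζ(5)`, no number of record moves.  The conjecture
node `LeadingCoeffIsDualConstantTerm` (D-exact) of `Families/DualConstantTerm` (P2 g6) is USED ONLY AS A
HYPOTHESIS of the last two theorems; it is not proved here.
PRIOR ART for D-exact / D: the dual constant term is the "torus period" `J_σ(n)` of McCarthy–Osburn–Straub
[MOS20, §3.2] (Math. Proc. Camb. Phil. Soc. 168 (2020); arXiv:1705.05586): "it is now natural to expect that the
leading coefficients `A_σ(n)` … are in fact equal to `J_σ(n)`. Likely, one can prove this equality in a general
uniform fashion" — proved there for `₈π₆` on the diagonal by recurrences; D-exact is that expectation for `₈π₈^∨`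
on the whole 8-parameter Brown–Zudilin family.

CONTENTS (standard axioms only):
* `dualConstantTerm_eq_ctSum` — **P2's `MvPolynomial` coefficient `dualConstantTerm a` IS the 3-fold binomial sum
  `DualCT.ctSum (numExp a) (gapExp a)`** (`Families/DualSpanProdCoeff`), hence computable by `decide`;
* KERNEL INSTANCES of D-exact, both sides decided in the kernel: the diagonal `n = 1, 2, 3` (`21, 2989, 714549`
  = Zudilin's `Q₁, Q₂, Q₃`), `(1,2,1,2,1,2,2,1) ↦ 133`, the sign case `Q(1,1,1,1,1,1,2,1) = −16`, `CT = 16`, and the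
  vanishing case `(3,3,1,1,3,1,2,2) ↦ 0` (before: only the `Q`-side of `n = 1`);
* `dualConstantTerm_diag` — on the diagonal the torus period is the clean triple sum `Σ diagTerm n i j l`
  (`C(n,i)C(n,j)C(n,l)C(i+j,n)C(n,2n−i−j−l)C(2n−l,n)²C(2n−j−l,n)`);
* **`dexact_diag_of_solvesRec`** — D-exact on the WHOLE diagonal (`|Q(n·1⁸)| = dualConstantTerm (n·1⁸)` for all
  `n`) follows from ONE recurrence statement: that this triple sum solves Brown–Zudilin's printed
  order-3 recursion (`BrownZudilin2022.SolvesRec`) — by the tree's `SymmetricRecursion.Q_solvesRec_holds`,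
  `SymRay.QOf_diag` and the initial values `1, 21, 2989`; the recurrence itself (a creative-telescoping certificate
  for the 3-fold sum, cf. [MOS20, Prop. 3.1] for `₈π₆`) is requested from the engines lane (engines REQUESTS
  `pub-zeta5-cert2-g7-dexact-diag-CT`) and is NOT proved here;
* `dualConstantTerm_mul_prod_le` — `CT[Λ_a] · g^B ≤ Λ-numerator(g)` for every `g ∈ [0,∞)⁶` (unconditional);
* `abs_QOf_mul_prod_le_of_conjDexact`, **`abs_QOf_ray_le_of_conjDexact`** — CONDITIONAL on D-exact:
  `|Q(n·a)| ≤ Λ_a(g)ⁿ` for every positive `g` and every `n`; composed with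
  `Families/RayGrowthDuality.inv_raySup_dual_eq_sInf_dualCell` (inf of `Λ_a` over the positive orthant = min of
  the integrand over the dual cell) this is the `limsup` half of CONJECTURE D.
Exact cross-checks outside the kernel (seat folder `work/dexact/`): the constant term is the same in all eight
gauges (any of the eight `σ`-points at infinity) on 13 test vectors; Brown–Zudilin's own residue chart for (17)
is NOT a vertex of the dual cell, so D-exact is a genuine two-vertex residue identity (open; [MOS20] as above).
-/

noncomputable section

open MvPolynomial Finset

namespace Summit.KontsevichZagierPeriods.Zeta5Search.Families.Cellular

open Literature.NumberTheory.Irrationality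


open DualCT

/-! ## The dual constant term in closed form; kernel instances of D-exact -/

/-- Numerator exponents `A = bzNum a` of the dual Laurent polynomial, as naturals (as in `dualConstantTerm`). -/
def numExp (a : Fin 8 → ℤ) : Fin 8 → ℕ := fun i => (bzNum a i).toNat

/-- Gap exponents `B = bzDen a` on the six finite gaps, as naturals (as in `dualConstantTerm`). -/
def gapExp (a : Fin 8 → ℤ) : Fin 6 → ℕ := fun w => (bzDen a (Fin.castLE (by norm_num) w)).toNat

/-- **P2's dual constant term is the 3-fold binomial sum**: `dualConstantTerm a = ctSum (numExp a) (gapExp a)`.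
This makes the `MvPolynomial` coefficient computable by `decide`. -/
theorem dualConstantTerm_eq_ctSum (a : Fin 8 → ℤ) : dualConstantTerm a = ctSum (numExp a) (gapExp a) := by
  unfold dualConstantTerm numExp gapExp
  exact coeff_dualSpanProd' _ _

/-- D-exact on the diagonal, `n = 1`: `|Q₁| = 21 = CT` (both sides in the kernel). -/
theorem dexact_diag_one : |BrownZudilin2022.QOf (fun _ => 1)| = dualConstantTerm (fun _ => 1) := by
  rw [dualConstantTerm_eq_ctSum]; decide

/-- D-exact on the diagonal, `n = 2`: `|Q₂| = 2989 = CT`. -/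
theorem dexact_diag_two : |BrownZudilin2022.QOf (fun _ => 2)| = dualConstantTerm (fun _ => 2) ∧
    dualConstantTerm (fun _ => 2) = 2989 := by
  rw [dualConstantTerm_eq_ctSum]; decide

/-- D-exact on the diagonal, `n = 3`: `|Q₃| = 714549 = CT`. -/
theorem dexact_diag_three : |BrownZudilin2022.QOf (fun _ => 3)| = dualConstantTerm (fun _ => 3) ∧
    dualConstantTerm (fun _ => 3) = 714549 := by
  rw [dualConstantTerm_eq_ctSum]; decide

/-- D-exact off the diagonal: `a = (1,2,1,2,1,2,2,1) ↦ 133`. -/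
theorem dexact_inst_12121221 :
    |BrownZudilin2022.QOf ![1, 2, 1, 2, 1, 2, 2, 1]| = dualConstantTerm ![1, 2, 1, 2, 1, 2, 2, 1] ∧
      dualConstantTerm ![1, 2, 1, 2, 1, 2, 2, 1] = 133 := by
  rw [dualConstantTerm_eq_ctSum]; decide

/-- A sign case of D-exact: `Q(1,1,1,1,1,1,2,1) = −16` while `CT = 16`. -/
theorem dexact_inst_11111121 :
    BrownZudilin2022.QOf ![1, 1, 1, 1, 1, 1, 2, 1] = -16 ∧ dualConstantTerm ![1, 1, 1, 1, 1, 1, 2, 1] = 16 := by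
  rw [dualConstantTerm_eq_ctSum]; decide

/-- A vanishing case of D-exact inside the cone `A, B ≥ 0`: `Q(3,3,1,1,3,1,2,2) = 0 = CT`. -/
theorem dexact_inst_33113122 :
    BrownZudilin2022.QOf ![3, 3, 1, 1, 3, 1, 2, 2] = 0 ∧ dualConstantTerm ![3, 3, 1, 1, 3, 1, 2, 2] = 0 := by
  rw [dualConstantTerm_eq_ctSum]; decide

/-! ## The diagonal: the torus period as a clean triple sum; D-exact for every `n` from ONE recurrence -/

/-- The summand of the DIAGONAL torus period `CT[Λⁿ]` in clean form:
`C(n,i)C(n,j)C(n,l)·C(i+j,n)·C(n,2n−i−j−l)·C(2n−l,n)²·C(2n−j−l,n)` (`i, j, l ≤ n`). -/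
def diagTerm (n i j l : ℕ) : ℤ :=
  (n.choose i * n.choose j * n.choose l * (i + j).choose n * n.choose (2 * n - i - j - l) *
    (2 * n - l).choose n * (2 * n - l).choose n * (2 * n - j - l).choose n : ℕ)

/-- On the diagonal the guarded summand `termCoeff` is the clean `diagTerm` (the guards hold exactly when no
binomial factor vanishes). -/
theorem termCoeff_diag (n i j l : ℕ) (hi : i ≤ n) (hj : j ≤ n) (hl : l ≤ n) :
    (n.choose i * (n.choose j * n.choose l) : ℤ) * termCoeff (fun _ => n) (fun _ => n) i j l
      = diagTerm n i j l := by
  unfold termCoeff diagTerm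
  simp only
  by_cases h1 : n ≤ i + j
  · by_cases h2 : i + j - n + l ≤ n
    · rw [if_pos h2]
      by_cases h3 : j + l ≤ n
      · have g : n - l + n - n + n - n + (n - j) - n + (n - (n - (i + j - n + l)) + (n - i)) = n := by omega
        rw [if_pos g]
        have e1 : n - (i + j - n + l) = 2 * n - i - j - l := by omega
        have e2 : n - l + n = 2 * n - l := by omega
        have e3 : 2 * n - l - n + n = 2 * n - l := by omega
        have e4 : 2 * n - l - n + (n - j) = 2 * n - j - l := by omega
        rw [e1, e2, e3, e4]
        push_cast
        ring
      · have z : (2 * n - j - l).choose n = 0 := Nat.choose_eq_zero_of_lt (by omega)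
        have z' : (n - l + n - n + n - n + (n - j)).choose n = 0 := by
          rw [show n - l + n - n + n - n + (n - j) = 2 * n - j - l by omega]; exact z
        rw [z', z]
        simp
    · rw [if_neg h2]
      have z : (2 * n - j - l).choose n = 0 := Nat.choose_eq_zero_of_lt (by omega)
      rw [z]
      simp
  · have z : (i + j).choose n = 0 := Nat.choose_eq_zero_of_lt (by omega)
    rw [z]
    simp

/-- **The diagonal torus period as a clean triple binomial sum**:
`dualConstantTerm (n·1⁸) = Σ_{i,j,l ≤ n} diagTerm n i j l` (= `1, 21, 2989, 714549, …`). -/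
theorem dualConstantTerm_diag (n : ℕ) :
    dualConstantTerm (SymRay.aDiag n) =
      ∑ i ∈ range (n + 1), ∑ j ∈ range (n + 1), ∑ l ∈ range (n + 1), diagTerm n i j l := by
  have hN : numExp (SymRay.aDiag n) = fun _ => n := by
    ext i; unfold numExp SymRay.aDiag; rw [bzNum_const]; simp
  have hB : gapExp (SymRay.aDiag n) = fun _ => n := by
    ext w; unfold gapExp SymRay.aDiag; rw [bzDen_const]; simp
  rw [dualConstantTerm_eq_ctSum, hN, hB]
  unfold ctSum
  refine Finset.sum_congr rfl fun i hi => Finset.sum_congr rfl fun j hj => Finset.sum_congr rfl fun l hl => ?_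
  rw [Finset.mem_range] at hi hj hl
  exact termCoeff_diag n i j l (by omega) (by omega) (by omega)

/-- **D-exact on the WHOLE diagonal, conditional on one recurrence.**  If the torus period
`n ↦ Σ_{i,j,l} diagTerm n i j l = CT[Λⁿ]` solves Brown–Zudilin's printed order-3 recursion of Sect. 2
(`BrownZudilin2022.SolvesRec`: `c₃(n)x_{n+1} − c₂(n)x_n − c₁(n)x_{n−1} + c₀(n)x_{n−2} = 0`, `n ≥ 2`; a
creative-telescoping statement for a 3-fold binomial sum, requested from the engines lane — NOT proved here), then
`|Q(n,…,n)| = dualConstantTerm (n·1⁸)` for every `n`: the tree's `SymmetricRecursion.Q_solvesRec_holds` (Zudilin's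
`Qₙ` solves the same recursion), `SymRay.QOf_diag` (`Q(n·1⁸) = Qₙ`) and the initial values `1, 21, 2989`
(`BrownZudilin2022.SolvesRec.ext_of_init`). -/
theorem dexact_diag_of_solvesRec
    (h : BrownZudilin2022.SolvesRec fun n =>
      ((∑ i ∈ range (n + 1), ∑ j ∈ range (n + 1), ∑ l ∈ range (n + 1), diagTerm n i j l : ℤ) : ℚ))
    (n : ℕ) : |BrownZudilin2022.QOf (SymRay.aDiag n)| = dualConstantTerm (SymRay.aDiag n) := by
  have h' : BrownZudilin2022.SolvesRec fun n => (dualConstantTerm (SymRay.aDiag n) : ℚ) := by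
    have : (fun n => (dualConstantTerm (SymRay.aDiag n) : ℚ)) = fun n =>
        ((∑ i ∈ range (n + 1), ∑ j ∈ range (n + 1), ∑ l ∈ range (n + 1), diagTerm n i j l : ℤ) : ℚ) := by
      funext n; rw [dualConstantTerm_diag]
    rw [this]; exact h
  have e := BrownZudilin2022.SolvesRec.ext_of_init SymmetricRecursion.Q_solvesRec_holds h'
    (by rw [dualConstantTerm_diag]; decide) (by rw [dualConstantTerm_diag]; decide)
    (by rw [dualConstantTerm_diag]; decide)
  have en := congrFun e n
  rw [SymRay.QOf_diag, abs_of_nonneg (by positivity)]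
  exact_mod_cast en

/-! ## Non-negativity and the bound `CT[Λ_a] ≤ Λ_a(g)`; consequences of D-exact for the growth of `Q` -/

/-- The numerator of the dual Laurent polynomial `Λ_a` evaluated at `g ∈ ℝ⁶`. -/
def dualNumEval (a : Fin 8 → ℤ) (g : Fin 6 → ℝ) : ℝ :=
  (dualSpanProd (numExp a)).eval₂ (Int.castRingHom ℝ) g

/-- **`CT[Λ_a] · g^B ≤ Λ-numerator(g)`** for every `g ≥ 0` (all coefficients are non-negative). -/
theorem dualConstantTerm_mul_prod_le (a : Fin 8 → ℤ) (g : Fin 6 → ℝ) (hg : ∀ w, 0 ≤ g w) :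
    (dualConstantTerm a : ℝ) * ∏ w, g w ^ gapExp a w ≤ dualNumEval a g := by
  unfold dualConstantTerm dualNumEval numExp gapExp
  simpa using coeff_mul_prod_le_eval₂ (dualSpanProd fun i => (bzNum a i).toNat)
    (coeff_dualSpanProd_nonneg _) g hg
    (Finsupp.equivFunOnFinite.symm fun w : Fin 6 => (bzDen a (Fin.castLE (by norm_num) w)).toNat)

/-- **D-exact ⇒ `|Q(a)| · g^B ≤ Λ-numerator(g)`** for every `a` with `A, B ≥ 0` and every `g ≥ 0`.
CONDITIONAL on the conjecture node `LeadingCoeffIsDualConstantTerm`. -/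
theorem abs_QOf_mul_prod_le_of_conjDexact (hD : LeadingCoeffIsDualConstantTerm) (a : Fin 8 → ℤ)
    (hA : ∀ i, 0 ≤ bzNum a i) (hB : ∀ i, 0 ≤ bzDen a i) (g : Fin 6 → ℝ) (hg : ∀ w, 0 ≤ g w) :
    (|BrownZudilin2022.QOf a| : ℝ) * ∏ w, g w ^ gapExp a w ≤ dualNumEval a g := by
  have : (|BrownZudilin2022.QOf a| : ℝ) = (dualConstantTerm a : ℝ) := by exact_mod_cast hD a hA hB
  rw [this]
  exact dualConstantTerm_mul_prod_le a g hg

/-- `numExp (n·a) = n · numExp a` on `A ≥ 0`. -/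
theorem numExp_smul (n : ℕ) {a : Fin 8 → ℤ} (hA : ∀ i, 0 ≤ bzNum a i) :
    numExp (fun i => (n : ℤ) * a i) = fun i => n * numExp a i := by
  ext i; simp only [numExp, bzNum_smul]; exact toNat_natCast_mul_of_nonneg (hA i)

/-- `gapExp (n·a) = n · gapExp a` on `B ≥ 0`. -/
theorem gapExp_smul (n : ℕ) {a : Fin 8 → ℤ} (hB : ∀ i, 0 ≤ bzDen a i) :
    gapExp (fun i => (n : ℤ) * a i) = fun w => n * gapExp a w := by
  ext w; simp only [gapExp, bzDen_smul]; exact toNat_natCast_mul_of_nonneg (hB _)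

/-- `Λ-numerator(n·a)(g) = Λ-numerator(a)(g)ⁿ`. -/
theorem dualNumEval_smul (n : ℕ) {a : Fin 8 → ℤ} (hA : ∀ i, 0 ≤ bzNum a i) (g : Fin 6 → ℝ) :
    dualNumEval (fun i => (n : ℤ) * a i) g = dualNumEval a g ^ n := by
  unfold dualNumEval
  rw [numExp_smul n hA, dualSpanProd_smul, eval₂_pow]

/-- **D-exact ⇒ the growth of the leading coefficients along every ray is bounded by the dual Laurent polynomial at
ANY positive point**: `|Q(n·a)| ≤ Λ_a(g)ⁿ` with `Λ_a(g) = Λ-numerator(g) / g^B`, for all `n`.  (The infimum of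
`Λ_a` over `g > 0` is the minimum of the integrand over the dual cell — `Families/RayGrowthDuality` — so this is
the `limsup` half of Conjecture D, conditional on D-exact.)  CONDITIONAL on `LeadingCoeffIsDualConstantTerm`. -/
theorem abs_QOf_ray_le_of_conjDexact (hD : LeadingCoeffIsDualConstantTerm) (a : Fin 8 → ℤ)
    (hA : ∀ i, 0 ≤ bzNum a i) (hB : ∀ i, 0 ≤ bzDen a i) (g : Fin 6 → ℝ) (hg : ∀ w, 0 < g w) (n : ℕ) :
    (|BrownZudilin2022.QOf (fun i => (n : ℤ) * a i)| : ℝ) ≤ (dualNumEval a g / ∏ w, g w ^ gapExp a w) ^ n := by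
  have hA' : ∀ i, 0 ≤ bzNum (fun i => (n : ℤ) * a i) i := by
    intro i; rw [bzNum_smul]; exact mul_nonneg (by positivity) (hA i)
  have hB' : ∀ i, 0 ≤ bzDen (fun i => (n : ℤ) * a i) i := by
    intro i; rw [bzDen_smul]; exact mul_nonneg (by positivity) (hB i)
  have h := abs_QOf_mul_prod_le_of_conjDexact hD _ hA' hB' g (fun w => (hg w).le)
  rw [dualNumEval_smul n hA, gapExp_smul n hB] at h
  have hD0 : 0 < ∏ w, g w ^ gapExp a w := Finset.prod_pos fun w _ => pow_pos (hg w) _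
  have e : (∏ w, g w ^ (n * gapExp a w)) = (∏ w, g w ^ gapExp a w) ^ n := by
    rw [← Finset.prod_pow]; refine Finset.prod_congr rfl fun w _ => ?_; rw [← pow_mul, mul_comm]
  simp only [e] at h
  rw [div_pow, le_div_iff₀ (pow_pos hD0 n)]
  exact h

end Summit.KontsevichZagierPeriods.Zeta5Search.Families.Cellular
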